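import Mathlib
import HarnessLib
import Summits.HubbardSuperconductivity.HubbardSuperconductivity.Theorems.KLProgrammeKLRegimeWickCrossContractionGramTailNorm

/-!
# Route `KLProgramme` — ENGINE child gen 8 (stmt-HubbardSuperconductivity-20437 `KLRegimeEngineV17F2`), stub (c) v2 class #3 (E.5 share), PROVING side:
# the `k`-line two-vertex term with a Gram tail in HYBRID form — output LABELS prescribed, output POSITIONS summed (one pinned)
# (cell gate-hubbard-kl, seat p5 g8; cure of FINDING (E5-VOL), KL STATUS 2026-08-27 p5 g8 18:03Z)

WHY.  The E.5 block is a VALUE of the quartic kernel at four momentum labels; its push-forward from the sector fields reads, per external leg, only the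
`≤ ρ₁` sector labels whose fat multiplier contains the external momentum, and sums the sector-field POSITIONS against plane waves of modulus `(βL²)⁻¹`.
So the sector-side quantity to bound is neither the VALUE form of `…GramTailValue` (all output positions pinned — its push-forward by row sums
`R = 13·|SpaceTimeIdx|/(βL²)` loses `|SpaceTimeIdx|³`, FINDING (E5-VOL)) nor the NORM form of `…GramTailNorm` (output labels summed — loses the level
gains), but the HYBRID `Σ_{Z : Z p = z, (Z j).2 = Ωo j ∀ j} ‖kernel(Π_k(a⁰b¹)) m (Z,s)‖`.  The Literature core `sum_crossContraction_le` is stated for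
arbitrary nonnegative size functions, so the hybrid is the norm-form proof with indicator-restricted size functions; the vertex sizes convert to
`ε·hubbardSectorKernelNorm … (prescribedTuples univ Ωe) …` with EXACTLY the prescriptions of the value form.
* §1 `sum_norm_kernel_crossContract_le_gram_labels` — generic lines on `P × S`, pinned output leg from `a`, output labels `Ωo : Fin m → S` prescribed;
* §2 `sum_norm_kernel_crossContract_pullback_le_gramF_labels` — lines `S(Ft)ᵀ·C_{sym t}·S(Ft)` in the FAMILY keying (k-uniform Gram base `Σ_tκ_t²`);
* engine currency (`ε·hubbardSectorKernelNorm` with the value-form prescriptions) and the assembled tails: sequel `…GramTailHybrid`.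
Pure bookkeeping over landed theorems; no definitions, no named facts, nothing about the model's sizes is asserted; nothing asserts superconductivity.
References (locators only): Feldman–Knörrer–Trubowitz, Rev. Math. Phys. 15 (2003) Prop. XII; Benfatto–Giuliani–Mastropietro, AHP 7 (2006) (2.76), (2.80).
-/

noncomputable section

namespace Summit.HubbardSuperconductivity.HubbardSuperconductivity.Theorems.KLRegimeWick

set_option linter.dupNamespace false -- summit = problem name (single-conjunct summit), D-0017

open Literature.MathematicalPhysics.QuantumLattice Literature.Probability.LatticeModels GrassmannAlgebra Finset Matrix Nat
open Summit.HubbardSuperconductivity.HubbardSuperconductivity.Theorems.KLRegimeSplit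
open scoped InnerProductSpace

/-! ## §1 The hybrid form with a Gram tail, generic lines -/

section Labels

variable {𝕜 : Type*} [RCLike 𝕜] {E : Type*} [NormedAddCommGroup E] [InnerProductSpace 𝕜 E]
variable {P S : Type*} [Fintype P] [Fintype S] [DecidableEq P] [DecidableEq S] {ι : Type*} [Fintype ι] [DecidableEq ι]

omit [Fintype P] [Fintype S] [DecidableEq P] [DecidableEq S] in
/-- A predicate on all output legs splits along a colouring equivalence into the legs of `a` and the legs of `b`. [folklore] -/
theorem forall_iff_forall_inl_and_inr {m m₀ m₁ : ℕ} (ε : Fin m₀ ⊕ Fin m₁ ≃ Fin m) (Q : Fin m → Prop) :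
    (∀ j, Q j) ↔ (∀ j, Q (ε (Sum.inl j))) ∧ ∀ j, Q (ε (Sum.inr j)) := by
  constructor
  · exact fun h => ⟨fun j => h _, fun j => h _⟩
  · rintro ⟨h0, h1⟩ j
    obtain ⟨x, rfl⟩ := ε.surjective j
    rcases x with j | j
    · exact h0 j
    · exact h1 j

/-- **The `k`-line two-vertex term, HYBRID form with a Gram tail, pinned at a free leg of `a`**: as `sum_norm_kernel_crossContract_le_gram` (lines
`0 … e'` explicit — line `0` by row sums, lines `1 … e'` sup × sector-diagonal — lines `e'+1 … k−1` Gram), but with the LABEL of EVERY output leg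
prescribed (`(Z j).2 = Ωo j`) on both sides: `a` summed over its contracted legs and its output POSITIONS (pinned leg fixed, output labels `σ₀`), `b` with
its line-`0` leg fixed, the sectors of its legs `1 … e'` fixed, its Gram legs summed and its output POSITIONS summed (output labels `σ₁`); the sizes
`Na`, `Nb` uniform over the prescriptions. [cite: FeldmanKnorrerTrubowitz2004, App. B] -/
theorem sum_norm_kernel_crossContract_le_gram_labels (q : P × S → Bool) (Cg : ι → Matrix (P × S) (P × S) 𝕜)
    (hCg : ∀ s X Y, q X = q Y → Cg s X Y = 0) (f g : ι → P × S → E) (κ : ι → ℝ)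
    (hf : ∀ s X, q X = true → ‖f s X‖ ≤ κ s) (hg : ∀ s Y, q Y = false → ‖g s Y‖ ≤ κ s)
    (hG : ∀ s X Y, q X = true → q Y = false → contr 𝕜 (Cg s) X Y = ⟪f s X, g s Y⟫_𝕜)
    {k e' m m₀ m₁ : ℕ} (he : e' + 1 ≤ k) (C : Fin k → Matrix (P × S) (P × S) 𝕜) (τ : Fin k → ι)
    (hCτ : ∀ i : Fin k, e' + 1 ≤ (i : ℕ) → C i = Cg (τ i))
    (a b : GrassmannAlgebra 𝕜 (P × S)) (s : Fin m → Fin 2) (hm₀ : (univ.filter fun i => s i = 0).card = m₀)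
    (hm₁ : (univ.filter fun i => s i = 1).card = m₁) (p : Fin m) (hp : s p = 0) (z : P × S) (Ωo : Fin m → S)
    {c : ℝ} (hc : ∀ X, ∑ Y, ‖contr 𝕜 (C (Fin.castLE he 0)) X Y‖ ≤ c)
    (D : Fin e' → S → S → ℝ) (hD : ∀ i σ τ, 0 ≤ D i σ τ) (d r : Fin e' → ℝ) (hd : ∀ i, 0 ≤ d i)
    (hLD : ∀ (i : Fin e') (X Y : P × S), ‖contr 𝕜 (C (Fin.castLE he i.succ)) X Y‖ ≤ d i * D i X.2 Y.2) (hr : ∀ i σ, ∑ τ, D i σ τ ≤ r i)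
    {Na Nb : ℝ} (hNb0 : 0 ≤ Nb)
    (hNa : ∀ (p₀ : Fin m₀) (σ₀ : Fin m₀ → S), ∑ X : Fin k → P × S,
      ∑ X₀ ∈ univ.filter (fun X₀ : Fin m₀ → P × S => X₀ p₀ = z ∧ ∀ j, (X₀ j).2 = σ₀ j), ‖kernel 𝕜 a (k + m₀) (Fin.append X X₀)‖ ≤ Na)
    (hNb : ∀ (Y₀ : P × S) (τ' : Fin e' → S) (σ₁ : Fin m₁ → S), ∑ y : Fin e' → P,
      ∑ Y₁ ∈ univ.filter (fun Y₁ : Fin m₁ → P × S => ∀ j, (Y₁ j).2 = σ₁ j),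
        ∑ Y ∈ univ.filter (fun Y : Fin k → P × S =>
          (fun i => Y (Fin.castLE he i)) = (Fin.cons Y₀ (fun i => (y i, τ' i)) : Fin (e' + 1) → P × S)),
            ‖kernel 𝕜 b (k + m₁) (Fin.append Y Y₁)‖ ≤ Nb) :
    ∑ Z ∈ univ.filter (fun Z : Fin m → P × S => Z p = z ∧ ∀ j, (Z j).2 = Ωo j),
        ‖kernel 𝕜 (((List.ofFn fun i => grassmannLaplacian 𝕜 (crossCov 𝕜 (C i))).reverse).prod
          (dblCopy 𝕜 0 a * dblCopy 𝕜 1 b)) m (fun i => (Z i, s i))‖ ≤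
      (((k + m₀).factorial * (k + m₁).factorial : ℝ) / (m.factorial * (k - (e' + 1)).factorial)) * (∑ s, κ s ^ 2) ^ (k - (e' + 1)) *
        (c * (∏ i, d i * r i) * Na * Nb) := by
  classical
  obtain ⟨h, σ, ε, h0, h1, hZ⟩ := exists_colouring_equiv (Γ := P × S) s hm₀ hm₁
  obtain ⟨p₀, hp₀⟩ : ∃ p₀ : Fin m₀, ε (Sum.inl p₀) = p := by
    rcases hq : ε.symm p with p₀ | j
    · exact ⟨p₀, by rw [← hq, Equiv.apply_symm_apply]⟩
    · exfalso
      have := h1 j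
      rw [← hq, Equiv.apply_symm_apply, hp] at this
      exact absurd this (by decide)
  subst hp₀
  -- the prescriptions seen by `a` and by `b`
  set σ₀ : Fin m₀ → S := fun j => Ωo (ε (Sum.inl j)) with hσ₀
  set σ₁ : Fin m₁ → S := fun j => Ωo (ε (Sum.inr j)) with hσ₁
  -- size functions over the explicit legs, Gram legs summed inside, output labels RESTRICTED
  set Ka : (Fin (e' + 1) → P × S) → (Fin m₀ → P × S) → ℝ := fun Xe X₀ =>
    ∑ X ∈ univ.filter (fun X : Fin k → P × S => (fun i => X (Fin.castLE he i)) = Xe), ‖kernel 𝕜 a (k + m₀) (Fin.append X X₀)‖ with hKa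
  set Kb : (Fin (e' + 1) → P × S) → (Fin m₁ → P × S) → ℝ := fun Ye Y₁ =>
    ∑ Y ∈ univ.filter (fun Y : Fin k → P × S => (fun i => Y (Fin.castLE he i)) = Ye), ‖kernel 𝕜 b (k + m₁) (Fin.append Y Y₁)‖ with hKb
  set Ka' : (Fin (e' + 1) → P × S) → (Fin m₀ → P × S) → ℝ := fun Xe X₀ =>
    if ∀ j, (X₀ j).2 = σ₀ j then Ka Xe X₀ else 0 with hKa'
  set Kb' : (Fin (e' + 1) → P × S) → (Fin m₁ → P × S) → ℝ := fun Ye Y₁ =>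
    if ∀ j, (Y₁ j).2 = σ₁ j then Kb Ye Y₁ else 0 with hKb'
  have hKa0 : ∀ Xe X₀, 0 ≤ Ka Xe X₀ := fun Xe X₀ => sum_nonneg fun _ _ => norm_nonneg _
  have hKb0 : ∀ Ye Y₁, 0 ≤ Kb Ye Y₁ := fun Ye Y₁ => sum_nonneg fun _ _ => norm_nonneg _
  have hKa'0 : ∀ Xe X₀, 0 ≤ Ka' Xe X₀ := fun Xe X₀ => by
    simp only [hKa']; split_ifs; exacts [hKa0 Xe X₀, le_rfl]
  have hKb'0 : ∀ Ye Y₁, 0 ≤ Kb' Ye Y₁ := fun Ye Y₁ => by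
    simp only [hKb']; split_ifs; exacts [hKb0 Ye Y₁, le_rfl]
  set F : ℝ := (((k + m₀).factorial * (k + m₁).factorial : ℝ) / (m.factorial * (k - (e' + 1)).factorial)) *
    (∑ s, κ s ^ 2) ^ (k - (e' + 1)) with hF
  have hF0 : 0 ≤ F := mul_nonneg (by positivity) (pow_nonneg (sum_nonneg fun s _ => sq_nonneg (κ s)) _)
  -- the per-tuple fibre bound
  have hterm : ∀ Z : Fin m → P × S,
      ‖kernel 𝕜 (((List.ofFn fun i => grassmannLaplacian 𝕜 (crossCov 𝕜 (C i))).reverse).prod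
          (dblCopy 𝕜 0 a * dblCopy 𝕜 1 b)) m (fun i => (Z i, s i))‖ ≤
        F * ∑ Xe : Fin (e' + 1) → P × S, ∑ Ye : Fin (e' + 1) → P × S, (∏ i, ‖contr 𝕜 (C (Fin.castLE he i)) (Xe i) (Ye i)‖) *
          Ka Xe (fun j => Z (ε (Sum.inl j))) * Kb Ye (fun j => Z (ε (Sum.inr j))) := by
    intro Z
    have hb := norm_kernel_crossContract_le_gram_fiber q Cg hCg f g κ hf hg hG he C τ hCτ a b (fun i => (Z i, s i)) h σ
      (fun j => Z (ε (Sum.inl j))) (fun j => Z (ε (Sum.inr j))) (hZ Z)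
    refine hb.trans (le_of_eq ?_)
    simp only [hF, hKa, hKb, mul_assoc]
  -- the label condition as an indicator inside the pinned sum
  set G : (Fin m₀ → P × S) → (Fin m₁ → P × S) → ℝ := fun X₀ Y₁ =>
    ∑ Xe : Fin (e' + 1) → P × S, ∑ Ye : Fin (e' + 1) → P × S, (∏ i, ‖contr 𝕜 (C (Fin.castLE he i)) (Xe i) (Ye i)‖) *
      Ka' Xe X₀ * Kb' Ye Y₁ with hGdef
  have hind : ∀ X₀ Y₁, (if (∀ j, (X₀ j).2 = σ₀ j) ∧ (∀ j, (Y₁ j).2 = σ₁ j) then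
      ∑ Xe : Fin (e' + 1) → P × S, ∑ Ye : Fin (e' + 1) → P × S, (∏ i, ‖contr 𝕜 (C (Fin.castLE he i)) (Xe i) (Ye i)‖) *
        Ka Xe X₀ * Kb Ye Y₁ else 0) = G X₀ Y₁ := by
    intro X₀ Y₁
    by_cases hA : ∀ j, (X₀ j).2 = σ₀ j
    · by_cases hB : ∀ j, (Y₁ j).2 = σ₁ j
      · rw [if_pos ⟨hA, hB⟩]
        simp only [hGdef, hKa', hKb', if_pos hA, if_pos hB]
      · rw [if_neg fun h => hB h.2]
        simp only [hGdef, hKb', if_neg hB, mul_zero, sum_const_zero]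
    · rw [if_neg fun h => hA h.1]
      simp only [hGdef, hKa', if_neg hA, mul_zero, zero_mul, sum_const_zero]
  calc ∑ Z ∈ univ.filter (fun Z : Fin m → P × S => Z (ε (Sum.inl p₀)) = z ∧ ∀ j, (Z j).2 = Ωo j),
        ‖kernel 𝕜 (((List.ofFn fun i => grassmannLaplacian 𝕜 (crossCov 𝕜 (C i))).reverse).prod
          (dblCopy 𝕜 0 a * dblCopy 𝕜 1 b)) m (fun i => (Z i, s i))‖
      ≤ ∑ Z ∈ univ.filter (fun Z : Fin m → P × S => Z (ε (Sum.inl p₀)) = z ∧ ∀ j, (Z j).2 = Ωo j),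
          F * ∑ Xe : Fin (e' + 1) → P × S, ∑ Ye : Fin (e' + 1) → P × S, (∏ i, ‖contr 𝕜 (C (Fin.castLE he i)) (Xe i) (Ye i)‖) *
            Ka Xe (fun j => Z (ε (Sum.inl j))) * Kb Ye (fun j => Z (ε (Sum.inr j))) := sum_le_sum fun Z _ => hterm Z
    _ = F * ∑ Z ∈ univ.filter (fun Z : Fin m → P × S => Z (ε (Sum.inl p₀)) = z),
          (if (∀ j, (Z (ε (Sum.inl j))).2 = σ₀ j) ∧ (∀ j, (Z (ε (Sum.inr j))).2 = σ₁ j) then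
            ∑ Xe : Fin (e' + 1) → P × S, ∑ Ye : Fin (e' + 1) → P × S, (∏ i, ‖contr 𝕜 (C (Fin.castLE he i)) (Xe i) (Ye i)‖) *
              Ka Xe (fun j => Z (ε (Sum.inl j))) * Kb Ye (fun j => Z (ε (Sum.inr j))) else 0) := by
        rw [mul_sum, ← filter_filter, sum_filter]
        refine sum_congr rfl fun Z _ => ?_
        have hiff := forall_iff_forall_inl_and_inr ε (fun j => (Z j).2 = Ωo j)
        by_cases hQ : ∀ j, (Z j).2 = Ωo j
        · rw [if_pos hQ, if_pos (hiff.1 hQ)]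
        · rw [if_neg hQ, if_neg (fun h' => hQ (hiff.2 h')), mul_zero]
    _ = F * ∑ X₀ ∈ univ.filter (fun X₀ : Fin m₀ → P × S => X₀ p₀ = z), ∑ Y₁ : Fin m₁ → P × S, G X₀ Y₁ := by
        rw [sum_filter_comp_sumEquiv_inl ε (fun X₀ Y₁ => if (∀ j, (X₀ j).2 = σ₀ j) ∧ (∀ j, (Y₁ j).2 = σ₁ j) then
          ∑ Xe : Fin (e' + 1) → P × S, ∑ Ye : Fin (e' + 1) → P × S, (∏ i, ‖contr 𝕜 (C (Fin.castLE he i)) (Xe i) (Ye i)‖) *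
            Ka Xe X₀ * Kb Ye Y₁ else 0) p₀ z]
        simp_rw [hind]
    _ ≤ F * (c * (∏ i, d i * r i) * Na * Nb) := by
        refine mul_le_mul_of_nonneg_left ?_ hF0
        have hNa' : ∑ Xe : Fin (e' + 1) → P × S, ∑ X₀ ∈ univ.filter (fun X₀ : Fin m₀ → P × S => X₀ p₀ = z), Ka' Xe X₀ ≤ Na := by
          have hrw : ∀ Xe : Fin (e' + 1) → P × S, ∑ X₀ ∈ univ.filter (fun X₀ : Fin m₀ → P × S => X₀ p₀ = z), Ka' Xe X₀ =
              ∑ X₀ ∈ univ.filter (fun X₀ : Fin m₀ → P × S => X₀ p₀ = z ∧ ∀ j, (X₀ j).2 = σ₀ j), Ka Xe X₀ := by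
            intro Xe
            simp only [hKa']
            rw [← sum_filter, filter_filter]
          simp_rw [hrw]
          rw [hKa, sum_sum_sum_fiber_eq he]
          exact hNa p₀ σ₀
        have hNb' : ∀ (Y₀ : P × S) (τ' : Fin e' → S), ∑ y : Fin e' → P, ∑ Y₁ : Fin m₁ → P × S,
            Kb' (Fin.cons Y₀ (fun i => (y i, τ' i))) Y₁ ≤ Nb := by
          intro Y₀ τ'
          have hrw : ∀ y : Fin e' → P, ∑ Y₁ : Fin m₁ → P × S, Kb' (Fin.cons Y₀ (fun i => (y i, τ' i))) Y₁ =
              ∑ Y₁ ∈ univ.filter (fun Y₁ : Fin m₁ → P × S => ∀ j, (Y₁ j).2 = σ₁ j), Kb (Fin.cons Y₀ (fun i => (y i, τ' i))) Y₁ := by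
            intro y
            simp only [hKb']
            rw [← sum_filter]
          simp_rw [hrw]
          exact hNb Y₀ τ' σ₁
        exact sum_crossContraction_le Ka' Kb' hKa'0 hKb'0 (fun i X Y => ‖contr 𝕜 (C (Fin.castLE he i)) X Y‖) (fun i X Y => norm_nonneg _)
          hc D hD d r hd hLD hr p₀ z hNb0 hNa' hNb'

end Labels

/-! ## §2 Lines `S(Ft)ᵀ·C_{sym t}·S(Ft)` in the family keying -/

section FamilyLabels

variable {L M N : ℕ} [NeZero L] {ι : Type*} [Fintype ι] [DecidableEq ι]

/-- Charges in `Fin 2` with `[a = 0] ↔ [b = 0]` are equal. -/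
private theorem fin_two_eq_of_iff'' {a b : Fin 2} (h : a = 0 ↔ b = 0) : a = b := by
  rw [Fin.ext_iff, Fin.ext_iff, Fin.val_zero] at h
  rw [Fin.ext_iff]
  have ha := a.isLt
  have hb := b.isLt
  omega

/-- **Hybrid form with a Gram tail, family keying, pinned at a free leg of `a`, output labels prescribed** (lines `S(Ft)ᵀ·C_{sym(τ i)}·S(Ft)`;
overlap `4ρ₀`, row sums `α`, entries `δ_i`, Gram half-norms `κ_s` per SYMBOL; base `Σ_{s∈ι} κ_s²`). [cite: BenfattoGiulianiMastropietro2006, §2.8 (2.80)] -/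
theorem sum_norm_kernel_crossContract_pullback_le_gramF_labels {k e' m m₀ m₁ : ℕ} (he : e' + 1 ≤ k) (β : ℝ) (Ft : Fin N → FreqMomentum L M → ℂ)
    {ρ₀ : ℕ} (hρ₀ : ∀ ω : Fin N, ((univ : Finset (Fin N)).filter fun ω' => ∃ q, Ft ω q * Ft ω' q ≠ 0).card ≤ ρ₀)
    (sym : ι → FreqMomentum L M × Fin 2 → ℂ) (τ : Fin k → ι) (κ : ι → ℝ)
    (hκF : ∀ (s : ι) (Y : SpaceTimeIdx L M × SectorLeg N), Y.2.2 = 0 → ‖sectorGramF L M β Ft (sym s) Y‖ ≤ κ s)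
    (hκG : ∀ (s : ι) (Y : SpaceTimeIdx L M × SectorLeg N), Y.2.2 = 1 → ‖sectorGramG L M β Ft (sym s) Y‖ ≤ κ s)
    (a b : GrassmannAlgebra ℂ (SpaceTimeIdx L M × SectorLeg N)) (s : Fin m → Fin 2)
    (hm₀ : (univ.filter fun i => s i = 0).card = m₀) (hm₁ : (univ.filter fun i => s i = 1).card = m₁) (p : Fin m) (hp : s p = 0)
    (z : SpaceTimeIdx L M × SectorLeg N) (Ωo : Fin m → SectorLeg N) {α : ℝ}
    (hrow : ∀ X, ∑ Y, ‖((sectorSubMatrix L M β Ft).transpose * normalCovariance L M (sym (τ (Fin.castLE he 0))) * sectorSubMatrix L M β Ft) X Y‖ ≤ α)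
    (hcol : ∀ Y, ∑ X, ‖((sectorSubMatrix L M β Ft).transpose * normalCovariance L M (sym (τ (Fin.castLE he 0))) * sectorSubMatrix L M β Ft) X Y‖ ≤ α)
    (δ : Fin e' → ℝ) (hδ : ∀ i, 0 ≤ δ i)
    (hent : ∀ (i : Fin e') X Y,
      ‖((sectorSubMatrix L M β Ft).transpose * normalCovariance L M (sym (τ (Fin.castLE he i.succ))) * sectorSubMatrix L M β Ft) X Y‖ ≤ δ i)
    {Na Nb : ℝ} (hNb0 : 0 ≤ Nb)
    (hNa : ∀ (p₀ : Fin m₀) (σ₀ : Fin m₀ → SectorLeg N), ∑ X : Fin k → SpaceTimeIdx L M × SectorLeg N,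
      ∑ X₀ ∈ univ.filter (fun X₀ : Fin m₀ → SpaceTimeIdx L M × SectorLeg N => X₀ p₀ = z ∧ ∀ j, (X₀ j).2 = σ₀ j),
        ‖kernel ℂ a (k + m₀) (Fin.append X X₀)‖ ≤ Na)
    (hNb : ∀ (Y₀ : SpaceTimeIdx L M × SectorLeg N) (τ' : Fin e' → SectorLeg N) (σ₁ : Fin m₁ → SectorLeg N), ∑ y : Fin e' → SpaceTimeIdx L M,
      ∑ Y₁ ∈ univ.filter (fun Y₁ : Fin m₁ → SpaceTimeIdx L M × SectorLeg N => ∀ j, (Y₁ j).2 = σ₁ j),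
        ∑ Y ∈ univ.filter (fun Y : Fin k → SpaceTimeIdx L M × SectorLeg N =>
          (fun i => Y (Fin.castLE he i)) = (Fin.cons Y₀ (fun i => (y i, τ' i)) : Fin (e' + 1) → SpaceTimeIdx L M × SectorLeg N)),
            ‖kernel ℂ b (k + m₁) (Fin.append Y Y₁)‖ ≤ Nb) :
    ∑ Z ∈ univ.filter (fun Z : Fin m → SpaceTimeIdx L M × SectorLeg N => Z p = z ∧ ∀ j, (Z j).2 = Ωo j),
        ‖kernel ℂ (((List.ofFn fun i => grassmannLaplacian ℂ (crossCov ℂ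
            ((sectorSubMatrix L M β Ft).transpose * normalCovariance L M (sym (τ i)) * sectorSubMatrix L M β Ft))).reverse).prod
          (dblCopy ℂ 0 a * dblCopy ℂ 1 b)) m (fun i => (Z i, s i))‖ ≤
      (((k + m₀).factorial * (k + m₁).factorial : ℝ) / (m.factorial * (k - (e' + 1)).factorial)) * (∑ t, κ t ^ 2) ^ (k - (e' + 1)) *
        (α * (∏ i, δ i * ((4 * ρ₀ : ℕ) : ℝ)) * Na * Nb) := by
  classical
  refine sum_norm_kernel_crossContract_le_gram_labels (fun Y : SpaceTimeIdx L M × SectorLeg N => decide (Y.2.2 = 0))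
    (fun t => (sectorSubMatrix L M β Ft).transpose * normalCovariance L M (sym t) * sectorSubMatrix L M β Ft)
    (fun t X Y hq => pullback_normalCovariance_apply_of_charge_eq β Ft (sym t) (fin_two_eq_of_iff'' (by simpa using hq)))
    (fun t => sectorGramF L M β Ft (sym t)) (fun t => sectorGramG L M β Ft (sym t)) κ
    (fun t X hX => hκF t X (by simpa using hX)) (fun t Y hY => hκG t Y ?_)
    (fun t X Y hX hY => contr_pullback_normalCovariance_eq_inner β Ft (sym t) (by simpa using hX) ?_)
    he (fun i => (sectorSubMatrix L M β Ft).transpose * normalCovariance L M (sym (τ i)) * sectorSubMatrix L M β Ft) τ (fun i _ => rfl)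
    a b s hm₀ hm₁ p hp z Ωo (sum_norm_contr_le _ hrow hcol)
    (fun _ σ τ'' => if (∃ q, Ft σ.1.1 q * Ft τ''.1.1 q ≠ 0) then (1 : ℝ) else 0) (fun _ σ τ'' => by positivity)
    δ (fun _ => ((4 * ρ₀ : ℕ) : ℝ)) hδ
    (fun i X Y => norm_contr_le_indicator_of_support _ (fun σ τ'' : SectorLeg N => ∃ q, Ft σ.1.1 q * Ft τ''.1.1 q ≠ 0)
      (fun σ τ'' ⟨q, hq⟩ => ⟨q, by rwa [mul_comm] at hq⟩) (hδ i) (hent i)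
      (fun X Y hXY => exists_mul_ne_zero_of_pullback_normalCovariance_ne_zero β Ft (sym _) hXY) X Y)
    (fun _ σ => sum_indicator_le_of_card_le (fun σ τ'' : SectorLeg N => ∃ q, Ft σ.1.1 q * Ft τ''.1.1 q ≠ 0) (fun σ' => ?_) σ) hNb0 hNa hNb
  · have h2 : (Y.2.2 : Fin 2) ≠ 0 := by simpa using hY
    omega
  · have h2 : (Y.2.2 : Fin 2) ≠ 0 := by simpa using hY
    omega
  · exact (card_filter_sectorLeg_le fun ω' => ∃ q, Ft σ'.1.1 q * Ft ω' q ≠ 0).trans (Nat.mul_le_mul_left 4 (hρ₀ σ'.1.1))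

end FamilyLabels

/-! ## §3 The hybrid form pinned at a free leg of `b` (generic lines) -/

section LabelsB

variable {𝕜 : Type*} [RCLike 𝕜] {E : Type*} [NormedAddCommGroup E] [InnerProductSpace 𝕜 E]
variable {P S : Type*} [Fintype P] [Fintype S] [DecidableEq P] [DecidableEq S] {ι : Type*} [Fintype ι] [DecidableEq ι]

/-- **The same, pinned at a free leg of `b`** (hybrid form, output labels prescribed): line `0` through its row sums (= column sums), `a` with its
line-`0` leg fixed, the sectors of its explicit legs fixed, its Gram legs summed and its output POSITIONS summed (labels `σ₀`), `b` pinned at a free leg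
with its contracted legs summed and its output POSITIONS summed (labels `σ₁`). [cite: FeldmanKnorrerTrubowitz2004, App. B] -/
theorem sum_norm_kernel_crossContract_le_gram_labels_of_eq_one (q : P × S → Bool) (Cg : ι → Matrix (P × S) (P × S) 𝕜)
    (hCg : ∀ s X Y, q X = q Y → Cg s X Y = 0) (f g : ι → P × S → E) (κ : ι → ℝ)
    (hf : ∀ s X, q X = true → ‖f s X‖ ≤ κ s) (hg : ∀ s Y, q Y = false → ‖g s Y‖ ≤ κ s)
    (hG : ∀ s X Y, q X = true → q Y = false → contr 𝕜 (Cg s) X Y = ⟪f s X, g s Y⟫_𝕜)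
    {k e' m m₀ m₁ : ℕ} (he : e' + 1 ≤ k) (C : Fin k → Matrix (P × S) (P × S) 𝕜) (τ : Fin k → ι)
    (hCτ : ∀ i : Fin k, e' + 1 ≤ (i : ℕ) → C i = Cg (τ i))
    (a b : GrassmannAlgebra 𝕜 (P × S)) (s : Fin m → Fin 2) (hm₀ : (univ.filter fun i => s i = 0).card = m₀)
    (hm₁ : (univ.filter fun i => s i = 1).card = m₁) (p : Fin m) (hp : s p = 1) (z : P × S) (Ωo : Fin m → S)
    {c : ℝ} (hc : ∀ X, ∑ Y, ‖contr 𝕜 (C (Fin.castLE he 0)) X Y‖ ≤ c)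
    (D : Fin e' → S → S → ℝ) (hD : ∀ i σ τ, 0 ≤ D i σ τ) (d r : Fin e' → ℝ) (hd : ∀ i, 0 ≤ d i)
    (hLD : ∀ (i : Fin e') (X Y : P × S), ‖contr 𝕜 (C (Fin.castLE he i.succ)) X Y‖ ≤ d i * D i X.2 Y.2) (hr : ∀ i τ, ∑ σ, D i σ τ ≤ r i)
    {Na Nb : ℝ} (hNa0 : 0 ≤ Na)
    (hNa : ∀ (X₀ : P × S) (σ' : Fin e' → S) (σ₀ : Fin m₀ → S), ∑ x : Fin e' → P,
      ∑ Z₀ ∈ univ.filter (fun Z₀ : Fin m₀ → P × S => ∀ j, (Z₀ j).2 = σ₀ j),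
        ∑ X ∈ univ.filter (fun X : Fin k → P × S =>
          (fun i => X (Fin.castLE he i)) = (Fin.cons X₀ (fun i => (x i, σ' i)) : Fin (e' + 1) → P × S)),
            ‖kernel 𝕜 a (k + m₀) (Fin.append X Z₀)‖ ≤ Na)
    (hNb : ∀ (p₁ : Fin m₁) (σ₁ : Fin m₁ → S), ∑ Y : Fin k → P × S,
      ∑ Y₁ ∈ univ.filter (fun Y₁ : Fin m₁ → P × S => Y₁ p₁ = z ∧ ∀ j, (Y₁ j).2 = σ₁ j), ‖kernel 𝕜 b (k + m₁) (Fin.append Y Y₁)‖ ≤ Nb) :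
    ∑ Z ∈ univ.filter (fun Z : Fin m → P × S => Z p = z ∧ ∀ j, (Z j).2 = Ωo j),
        ‖kernel 𝕜 (((List.ofFn fun i => grassmannLaplacian 𝕜 (crossCov 𝕜 (C i))).reverse).prod
          (dblCopy 𝕜 0 a * dblCopy 𝕜 1 b)) m (fun i => (Z i, s i))‖ ≤
      (((k + m₀).factorial * (k + m₁).factorial : ℝ) / (m.factorial * (k - (e' + 1)).factorial)) * (∑ s, κ s ^ 2) ^ (k - (e' + 1)) *
        (c * (∏ i, d i * r i) * Na * Nb) := by
  classical
  obtain ⟨h, σ, ε, h0, h1, hZ⟩ := exists_colouring_equiv (Γ := P × S) s hm₀ hm₁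
  obtain ⟨p₁, hp₁⟩ : ∃ p₁ : Fin m₁, ε (Sum.inr p₁) = p := by
    rcases hq : ε.symm p with j | p₁
    · exfalso
      have := h0 j
      rw [← hq, Equiv.apply_symm_apply, hp] at this
      exact absurd this (by decide)
    · exact ⟨p₁, by rw [← hq, Equiv.apply_symm_apply]⟩
  subst hp₁
  set σ₀ : Fin m₀ → S := fun j => Ωo (ε (Sum.inl j)) with hσ₀
  set σ₁ : Fin m₁ → S := fun j => Ωo (ε (Sum.inr j)) with hσ₁
  set Ka : (Fin (e' + 1) → P × S) → (Fin m₀ → P × S) → ℝ := fun Xe X₀ =>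
    ∑ X ∈ univ.filter (fun X : Fin k → P × S => (fun i => X (Fin.castLE he i)) = Xe), ‖kernel 𝕜 a (k + m₀) (Fin.append X X₀)‖ with hKa
  set Kb : (Fin (e' + 1) → P × S) → (Fin m₁ → P × S) → ℝ := fun Ye Y₁ =>
    ∑ Y ∈ univ.filter (fun Y : Fin k → P × S => (fun i => Y (Fin.castLE he i)) = Ye), ‖kernel 𝕜 b (k + m₁) (Fin.append Y Y₁)‖ with hKb
  set Ka' : (Fin (e' + 1) → P × S) → (Fin m₀ → P × S) → ℝ := fun Xe X₀ =>
    if ∀ j, (X₀ j).2 = σ₀ j then Ka Xe X₀ else 0 with hKa'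
  set Kb' : (Fin (e' + 1) → P × S) → (Fin m₁ → P × S) → ℝ := fun Ye Y₁ =>
    if ∀ j, (Y₁ j).2 = σ₁ j then Kb Ye Y₁ else 0 with hKb'
  have hKa0 : ∀ Xe X₀, 0 ≤ Ka Xe X₀ := fun Xe X₀ => sum_nonneg fun _ _ => norm_nonneg _
  have hKb0 : ∀ Ye Y₁, 0 ≤ Kb Ye Y₁ := fun Ye Y₁ => sum_nonneg fun _ _ => norm_nonneg _
  have hKa'0 : ∀ Xe X₀, 0 ≤ Ka' Xe X₀ := fun Xe X₀ => by
    simp only [hKa']; split_ifs; exacts [hKa0 Xe X₀, le_rfl]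
  have hKb'0 : ∀ Ye Y₁, 0 ≤ Kb' Ye Y₁ := fun Ye Y₁ => by
    simp only [hKb']; split_ifs; exacts [hKb0 Ye Y₁, le_rfl]
  set F : ℝ := (((k + m₀).factorial * (k + m₁).factorial : ℝ) / (m.factorial * (k - (e' + 1)).factorial)) *
    (∑ s, κ s ^ 2) ^ (k - (e' + 1)) with hF
  have hF0 : 0 ≤ F := mul_nonneg (by positivity) (pow_nonneg (sum_nonneg fun s _ => sq_nonneg (κ s)) _)
  have hterm : ∀ Z : Fin m → P × S,
      ‖kernel 𝕜 (((List.ofFn fun i => grassmannLaplacian 𝕜 (crossCov 𝕜 (C i))).reverse).prod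
          (dblCopy 𝕜 0 a * dblCopy 𝕜 1 b)) m (fun i => (Z i, s i))‖ ≤
        F * ∑ Xe : Fin (e' + 1) → P × S, ∑ Ye : Fin (e' + 1) → P × S, (∏ i, ‖contr 𝕜 (C (Fin.castLE he i)) (Xe i) (Ye i)‖) *
          Ka Xe (fun j => Z (ε (Sum.inl j))) * Kb Ye (fun j => Z (ε (Sum.inr j))) := by
    intro Z
    have hb := norm_kernel_crossContract_le_gram_fiber q Cg hCg f g κ hf hg hG he C τ hCτ a b (fun i => (Z i, s i)) h σ
      (fun j => Z (ε (Sum.inl j))) (fun j => Z (ε (Sum.inr j))) (hZ Z)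
    refine hb.trans (le_of_eq ?_)
    simp only [hF, hKa, hKb, mul_assoc]
  set G : (Fin m₀ → P × S) → (Fin m₁ → P × S) → ℝ := fun X₀ Y₁ =>
    ∑ Xe : Fin (e' + 1) → P × S, ∑ Ye : Fin (e' + 1) → P × S, (∏ i, ‖contr 𝕜 (C (Fin.castLE he i)) (Xe i) (Ye i)‖) *
      Ka' Xe X₀ * Kb' Ye Y₁ with hGdef
  have hind : ∀ X₀ Y₁, (if (∀ j, (X₀ j).2 = σ₀ j) ∧ (∀ j, (Y₁ j).2 = σ₁ j) then
      ∑ Xe : Fin (e' + 1) → P × S, ∑ Ye : Fin (e' + 1) → P × S, (∏ i, ‖contr 𝕜 (C (Fin.castLE he i)) (Xe i) (Ye i)‖) *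
        Ka Xe X₀ * Kb Ye Y₁ else 0) = G X₀ Y₁ := by
    intro X₀ Y₁
    by_cases hA : ∀ j, (X₀ j).2 = σ₀ j
    · by_cases hB : ∀ j, (Y₁ j).2 = σ₁ j
      · rw [if_pos ⟨hA, hB⟩]
        simp only [hGdef, hKa', hKb', if_pos hA, if_pos hB]
      · rw [if_neg fun h => hB h.2]
        simp only [hGdef, hKb', if_neg hB, mul_zero, sum_const_zero]
    · rw [if_neg fun h => hA h.1]
      simp only [hGdef, hKa', if_neg hA, mul_zero, zero_mul, sum_const_zero]
  calc ∑ Z ∈ univ.filter (fun Z : Fin m → P × S => Z (ε (Sum.inr p₁)) = z ∧ ∀ j, (Z j).2 = Ωo j),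
        ‖kernel 𝕜 (((List.ofFn fun i => grassmannLaplacian 𝕜 (crossCov 𝕜 (C i))).reverse).prod
          (dblCopy 𝕜 0 a * dblCopy 𝕜 1 b)) m (fun i => (Z i, s i))‖
      ≤ ∑ Z ∈ univ.filter (fun Z : Fin m → P × S => Z (ε (Sum.inr p₁)) = z ∧ ∀ j, (Z j).2 = Ωo j),
          F * ∑ Xe : Fin (e' + 1) → P × S, ∑ Ye : Fin (e' + 1) → P × S, (∏ i, ‖contr 𝕜 (C (Fin.castLE he i)) (Xe i) (Ye i)‖) *
            Ka Xe (fun j => Z (ε (Sum.inl j))) * Kb Ye (fun j => Z (ε (Sum.inr j))) := sum_le_sum fun Z _ => hterm Z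
    _ = F * ∑ Z ∈ univ.filter (fun Z : Fin m → P × S => Z (ε (Sum.inr p₁)) = z),
          (if (∀ j, (Z (ε (Sum.inl j))).2 = σ₀ j) ∧ (∀ j, (Z (ε (Sum.inr j))).2 = σ₁ j) then
            ∑ Xe : Fin (e' + 1) → P × S, ∑ Ye : Fin (e' + 1) → P × S, (∏ i, ‖contr 𝕜 (C (Fin.castLE he i)) (Xe i) (Ye i)‖) *
              Ka Xe (fun j => Z (ε (Sum.inl j))) * Kb Ye (fun j => Z (ε (Sum.inr j))) else 0) := by
        rw [mul_sum, ← filter_filter, sum_filter]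
        refine sum_congr rfl fun Z _ => ?_
        have hiff := forall_iff_forall_inl_and_inr ε (fun j => (Z j).2 = Ωo j)
        by_cases hQ : ∀ j, (Z j).2 = Ωo j
        · rw [if_pos hQ, if_pos (hiff.1 hQ)]
        · rw [if_neg hQ, if_neg (fun h' => hQ (hiff.2 h')), mul_zero]
    _ = F * ∑ Y₁ ∈ univ.filter (fun Y₁ : Fin m₁ → P × S => Y₁ p₁ = z), ∑ X₀ : Fin m₀ → P × S, G X₀ Y₁ := by
        rw [sum_filter_comp_sumEquiv_inr ε (fun X₀ Y₁ => if (∀ j, (X₀ j).2 = σ₀ j) ∧ (∀ j, (Y₁ j).2 = σ₁ j) then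
          ∑ Xe : Fin (e' + 1) → P × S, ∑ Ye : Fin (e' + 1) → P × S, (∏ i, ‖contr 𝕜 (C (Fin.castLE he i)) (Xe i) (Ye i)‖) *
            Ka Xe X₀ * Kb Ye Y₁ else 0) p₁ z]
        simp_rw [hind]
    _ ≤ F * (c * (∏ i, d i * r i) * Na * Nb) := by
        refine mul_le_mul_of_nonneg_left ?_ hF0
        have hc' : ∀ Y, ∑ X, ‖contr 𝕜 (C (Fin.castLE he 0)) X Y‖ ≤ c := fun Y => by
          simp_rw [norm_contr_swap (C (Fin.castLE he 0)) Y]; exact hc Y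
        have hNa' : ∀ (X₀ : P × S) (σ' : Fin e' → S), ∑ x : Fin e' → P, ∑ Z₀ : Fin m₀ → P × S,
            Ka' (Fin.cons X₀ (fun i => (x i, σ' i))) Z₀ ≤ Na := by
          intro X₀ σ'
          have hrw : ∀ x : Fin e' → P, ∑ Z₀ : Fin m₀ → P × S, Ka' (Fin.cons X₀ (fun i => (x i, σ' i))) Z₀ =
              ∑ Z₀ ∈ univ.filter (fun Z₀ : Fin m₀ → P × S => ∀ j, (Z₀ j).2 = σ₀ j), Ka (Fin.cons X₀ (fun i => (x i, σ' i))) Z₀ := by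
            intro x
            simp only [hKa']
            rw [← sum_filter]
          simp_rw [hrw]
          exact hNa X₀ σ' σ₀
        have hNb' : ∑ Ye : Fin (e' + 1) → P × S, ∑ Y₁ ∈ univ.filter (fun Y₁ : Fin m₁ → P × S => Y₁ p₁ = z), Kb' Ye Y₁ ≤ Nb := by
          have hrw : ∀ Ye : Fin (e' + 1) → P × S, ∑ Y₁ ∈ univ.filter (fun Y₁ : Fin m₁ → P × S => Y₁ p₁ = z), Kb' Ye Y₁ =
              ∑ Y₁ ∈ univ.filter (fun Y₁ : Fin m₁ → P × S => Y₁ p₁ = z ∧ ∀ j, (Y₁ j).2 = σ₁ j), Kb Ye Y₁ := by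
            intro Ye
            simp only [hKb']
            rw [← sum_filter, filter_filter]
          simp_rw [hrw]
          rw [hKb, sum_sum_sum_fiber_eq he]
          exact hNb p₁ σ₁
        exact sum_crossContraction_le_symm Ka' Kb' hKa'0 hKb'0 (fun i X Y => ‖contr 𝕜 (C (Fin.castLE he i)) X Y‖) (fun i X Y => norm_nonneg _)
          hc' D hD d r hd hLD hr p₁ z hNa0 hNa' hNb'


end LabelsB

end Summit.HubbardSuperconductivity.HubbardSuperconductivity.Theorems.KLRegimeWick

end
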